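import Mathlib
import Literature.Probability.RandomPlanarGeometry.SelfAvoidingWalk
import Summits.CriticalPhenomena.SAWScalingLimit.Theorems.SAWRestrictionRigidityAxiomsOfLimitMarkovThickeningExtension
import HarnessLib

/-!
# Stopping on arbitrary vanishing thickenings; countability of the lattice sample spaces

Crux `AxiomsOfLimit` (stmt-CriticalPhenomena-1370), line `registered` (= `split`), stub `stub_markovOfLimit`: Markov passage,
part 7 (lead c3). Theorems only. Two small residues (R3 and the sample-space side of R2/(b) in the lead's census):

* `Curve.tendsto_hitParam_cthickening_of_tendsto`, `Curve.tendsto_stopAt_cthickening_of_tendsto`,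
  `Curve.tendsto_startFrom_cthickening_of_tendsto`, `CurveClass.tendsto_stopAt_cthickening_of_tendsto`,
  `CurveClass.tendsto_startFrom_cthickening_of_tendsto` — the stopped / final segments at the closed thickenings
  `cthickening (r n) F` converge to those at `F` along EVERY real sequence `r n → 0` (not only `1/(n+1)`: antitonicity of
  `ρ ↦ hitParam (cthickening ρ F) γ` and the tree's `1/(n+1)` case) — needed because only GENERIC thickening levels are grazing-free;
* `markov_clause_of_cthickening_seq` — part 5 along such a sequence: the `markov` clause at a closed `F` from the tensor identities
  at `cthickening (r n) F` and tip continuity of the kernel along these pasts;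
* `countable_domainSAW` — the self-avoiding walks of a discrete domain between two sites form a countable type (a chord is
  determined by its vertex list), so part 4 (`exists_elementary_condKernel`, `[Countable Ω]`) applies to every critical SAW law.

References: G. F. Lawler, O. Schramm, W. Werner, Acta Math. 187 (2001), §2; W. Werner (2007), §3.2 (2). All [folklore].
-/

noncomputable section

open MeasureTheory ProbabilityTheory Filter Topology Set Metric BoundedContinuousFunction
open scoped NNReal ENNReal unitInterval

namespace Summit.CriticalPhenomena.SAWScalingLimit.Theorems.AxiomsOfLimitMarkov

open Literature.Probability.RandomPlanarGeometry

/-! ### Arbitrary vanishing thickening levels -/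

section Levels

variable {E : Type*} [MetricSpace E]

/-- **`hitParam (cthickening (r n) F) γ → hitParam F γ`** for closed `F` along every real sequence `r n → 0`: the map
`ρ ↦ hitParam (cthickening ρ F) γ` is antitone and bounded by `hitParam F γ`, and converges along `ρ = 1/(k+1)` (tree
`Curve.tendsto_hitParam_cthickening`). [folklore] -/
theorem Curve.tendsto_hitParam_cthickening_of_tendsto {F : Set E} (hF : IsClosed F) (γ : Curve E) {r : ℕ → ℝ}
    (hr0 : Tendsto r atTop (𝓝 0)) :
    Tendsto (fun n => γ.hitParam (cthickening (r n) F)) atTop (𝓝 (γ.hitParam F)) := by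
  have hle : ∀ n, γ.hitParam (cthickening (r n) F) ≤ γ.hitParam F := fun n =>
    Curve.hitParam_mono (self_subset_cthickening F) γ
  have hk := Curve.tendsto_hitParam_cthickening hF γ
  rw [tendsto_order]
  refine ⟨fun a ha => ?_, fun b hb => Eventually.of_forall fun n => (hle n).trans_lt hb⟩
  -- pick a level `1/(k+1)` whose hitting parameter already exceeds `a`, then `r n ≤ 1/(k+1)` eventually
  obtain ⟨k, hk'⟩ := ((tendsto_order.1 hk).1 a ha).exists
  have hpos : (0 : ℝ) < 1 / ((k : ℝ) + 1) := by positivity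
  filter_upwards [(tendsto_order.1 hr0).2 _ hpos] with n hn
  refine hk'.trans_le ?_
  exact Curve.hitParam_mono (cthickening_mono hn.le F) γ

/-- **`stopAt (cthickening (r n) F) γ → stopAt F γ`** along every real sequence `r n → 0` (closed `F`). [folklore] -/
theorem Curve.tendsto_stopAt_cthickening_of_tendsto {F : Set E} (hF : IsClosed F) (γ : Curve E) {r : ℕ → ℝ}
    (hr0 : Tendsto r atTop (𝓝 0)) :
    Tendsto (fun n => γ.stopAt (cthickening (r n) F)) atTop (𝓝 (γ.stopAt F)) := by
  have hlim := Curve.tendsto_hitParam_cthickening_of_tendsto hF γ hr0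
  have hlimI : Tendsto (fun n : ℕ =>
      (⟨γ.hitParam (cthickening (r n) F), γ.hitParam_mem_Icc _⟩ : I)) atTop
      (𝓝 ⟨γ.hitParam F, γ.hitParam_mem_Icc F⟩) := by
    rw [tendsto_subtype_rng]; exact hlim
  have h := Curve.tendsto_dist_comp_affineClamp γ hlimI (fun _ => 0) (fun u => (u : ℝ))
    (fun u v => by simp) (fun u v => le_rfl)
  rw [tendsto_iff_dist_tendsto_zero]
  refine h.congr fun n => ?_
  rw [dist_comm]
  rfl

/-- **`startFrom (cthickening (r n) F) γ → startFrom F γ`** along every real sequence `r n → 0` (closed `F`). [folklore] -/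
theorem Curve.tendsto_startFrom_cthickening_of_tendsto {F : Set E} (hF : IsClosed F) (γ : Curve E) {r : ℕ → ℝ}
    (hr0 : Tendsto r atTop (𝓝 0)) :
    Tendsto (fun n => γ.startFrom (cthickening (r n) F)) atTop (𝓝 (γ.startFrom F)) := by
  have hlim := Curve.tendsto_hitParam_cthickening_of_tendsto hF γ hr0
  have hlimI : Tendsto (fun n : ℕ =>
      (⟨γ.hitParam (cthickening (r n) F), γ.hitParam_mem_Icc _⟩ : I)) atTop
      (𝓝 ⟨γ.hitParam F, γ.hitParam_mem_Icc F⟩) := by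
    rw [tendsto_subtype_rng]; exact hlim
  have h := Curve.tendsto_dist_comp_affineClamp γ hlimI (fun u => (u : ℝ)) (fun u => 1 - (u : ℝ))
    (fun u v => le_rfl) (fun u v => by rw [show (1 - (u : ℝ)) - (1 - v) = -((u : ℝ) - v) by ring, abs_neg])
  rw [tendsto_iff_dist_tendsto_zero]
  refine h.congr fun n => ?_
  rw [dist_comm]
  rfl

/-- Class-level form of `Curve.tendsto_stopAt_cthickening_of_tendsto`. [folklore] -/
theorem CurveClass.tendsto_stopAt_cthickening_of_tendsto {F : Set E} (hF : IsClosed F) (c : CurveClass E)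
    {r : ℕ → ℝ} (hr0 : Tendsto r atTop (𝓝 0)) :
    Tendsto (fun n => CurveClass.stopAt (cthickening (r n) F) c) atTop (𝓝 (CurveClass.stopAt F c)) :=
  (CurveClass.continuous_mk.tendsto _).comp (Curve.tendsto_stopAt_cthickening_of_tendsto hF c.out hr0)

/-- Class-level form of `Curve.tendsto_startFrom_cthickening_of_tendsto`. [folklore] -/
theorem CurveClass.tendsto_startFrom_cthickening_of_tendsto {F : Set E} (hF : IsClosed F) (c : CurveClass E)
    {r : ℕ → ℝ} (hr0 : Tendsto r atTop (𝓝 0)) :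
    Tendsto (fun n => CurveClass.startFrom (cthickening (r n) F) c) atTop (𝓝 (CurveClass.startFrom F c)) :=
  (CurveClass.continuous_mk.tendsto _).comp (Curve.tendsto_startFrom_cthickening_of_tendsto hF c.out hr0)

end Levels

/-! ### Part 5 along an arbitrary vanishing sequence of levels -/

/-- **The `markov` clause at a closed `F` from generic thickening levels.** For ANY real sequence `r n → 0`: if the tensor
identities hold at every `cthickening (r n) F` and the kernel is tip-continuous along `stopAt (cthickening (r n) F) γ → stopAt F γ`
for `μ`-a.e. `γ`, then the `markov` clause holds at `F` (part 5 `markov_clause_of_approx`; the segments converge for every class).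
[folklore] -/
theorem markov_clause_of_cthickening_seq (μ : Measure (CurveClass ℂ)) [IsFiniteMeasure μ]
    (κ : Kernel (CurveClass ℂ) (CurveClass ℂ)) [IsFiniteKernel κ] {F : Set ℂ} (hF : IsClosed F) {r : ℕ → ℝ}
    (hr0 : Tendsto r atTop (𝓝 0))
    (hTC : ∀ g : CurveClass ℂ →ᵇ ℝ, ∀ᵐ γ ∂μ,
      Tendsto (fun n => ∫ η, g η ∂(κ (γ.stopAt (cthickening (r n) F)))) atTop (𝓝 (∫ η, g η ∂(κ (γ.stopAt F)))))
    (hn : ∀ n (f g : CurveClass ℂ →ᵇ ℝ),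
      ∫ γ, f (γ.stopAt (cthickening (r n) F)) * g (γ.startFrom (cthickening (r n) F)) ∂μ =
        ∫ γ, f (γ.stopAt (cthickening (r n) F)) * (∫ η, g η ∂(κ (γ.stopAt (cthickening (r n) F)))) ∂μ)
    {S T : Set (CurveClass ℂ)} (hS : MeasurableSet S) (hT : MeasurableSet T) :
    μ (CurveClass.stopAt F ⁻¹' S ∩ CurveClass.startFrom F ⁻¹' T) =
      ∫⁻ γ in CurveClass.stopAt F ⁻¹' S, κ (γ.stopAt F) T ∂μ :=
  markov_clause_of_approx μ κ (fun _ => isClosed_cthickening) hF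
    (Eventually.of_forall fun γ => CurveClass.tendsto_stopAt_cthickening_of_tendsto hF γ hr0)
    (Eventually.of_forall fun γ => CurveClass.tendsto_startFrom_cthickening_of_tendsto hF γ hr0) hTC hn hS hT

/-! ### Countability of the lattice sample spaces -/

/-- **The self-avoiding walks of `Ω_δ` from `a` to `b` form a countable type**: a chord is determined by its vertex list
(`SimpleGraph.Walk.ext_support`), a `List (Site 2)`. Hence part 4 (`exists_elementary_condKernel`) applies to the critical SAW
laws `SAW.law Ω δ a b`. [folklore] -/
theorem countable_domainSAW (Ω : Set ℂ) (δ : ℝ) (a b : Literature.Probability.LatticeModels.Site 2) :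
    Countable (SAW.DomainSAW Ω δ a b) := by
  refine Function.Injective.countable (f := fun γ : SAW.DomainSAW Ω δ a b => γ.walk.support) ?_
  intro γ₁ γ₂ h
  obtain ⟨w₁, p₁⟩ := γ₁
  obtain ⟨w₂, p₂⟩ := γ₂
  have hw : w₁ = w₂ := SimpleGraph.Walk.ext_support h
  subst hw
  rfl


/-! ### Registered sub-goal of crux stmt-CriticalPhenomena-1370 (line `registered`, stub `stub_markovOfLimit`) -/

/-- **Registered sub-goal `stub_markovClauseOfThickeningSeq`** (crux stmt-CriticalPhenomena-1370, Markov passage, part 7):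
`markov_clause_of_cthickening_seq` with all binders explicit, notation-free: the `markov` clause at a closed `F` from the tensor
identities at `cthickening (r n) F` along ANY real sequence `r n → 0` and tip continuity of the kernel. [folklore] -/
theorem stub_markovClauseOfThickeningSeq :
    ∀ (μ : MeasureTheory.Measure (Literature.Probability.RandomPlanarGeometry.CurveClass ℂ)) [MeasureTheory.IsFiniteMeasure μ] (κ : ProbabilityTheory.Kernel (Literature.Probability.RandomPlanarGeometry.CurveClass ℂ) (Literature.Probability.RandomPlanarGeometry.CurveClass ℂ)) [ProbabilityTheory.IsFiniteKernel κ] (F : Set ℂ), IsClosed F → ∀ (r : ℕ → ℝ), Filter.Tendsto r Filter.atTop (nhds 0) → (∀ g : BoundedContinuousFunction (Literature.Probability.RandomPlanarGeometry.CurveClass ℂ) ℝ, Filter.Eventually (fun γ => Filter.Tendsto (fun n : ℕ => MeasureTheory.integral (κ (γ.stopAt (Metric.cthickening (r n) F))) (fun η => g η)) Filter.atTop (nhds (MeasureTheory.integral (κ (γ.stopAt F)) (fun η => g η)))) (MeasureTheory.ae μ)) → (∀ (n : ℕ) (f g : BoundedContinuousFunction (Literature.Probability.RandomPlanarGeometry.CurveClass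 ℂ) ℝ), MeasureTheory.integral μ (fun γ => f (γ.stopAt (Metric.cthickening (r n) F)) * g (γ.startFrom (Metric.cthickening (r n) F))) = MeasureTheory.integral μ (fun γ => f (γ.stopAt (Metric.cthickening (r n) F)) * MeasureTheory.integral (κ (γ.stopAt (Metric.cthickening (r n) F))) (fun η => g η))) → ∀ S T : Set (Literature.Probability.RandomPlanarGeometry.CurveClass ℂ), MeasurableSet S → MeasurableSet T → μ (Literature.Probability.RandomPlanarGeometry.CurveClass.stopAt F ⁻¹' S ∩ Literature.Probability.RandomPlanarGeometry.CurveClass.startFrom F ⁻¹' T) = MeasureTheory.lintegral (μ.restrict (Literature.Probability.RandomPlanarGeometry.CurveClass.stopAt F ⁻¹' S)) (fun γ => κ (γ.stopAt F) T) :=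
  fun μ _ κ _ _ hF _ hr0 hTC hn _ _ hS hT => markov_clause_of_cthickening_seq μ κ hF hr0 hTC hn hS hT

end Summit.CriticalPhenomena.SAWScalingLimit.Theorems.AxiomsOfLimitMarkov

end
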